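import Literature.MathematicalPhysics.QuantumFieldTheory.Balaban1983to89.B6SectCPositivity
import Literature.MathematicalPhysics.QuantumFieldTheory.Balaban1983to89.B6Eq2112Lebesgue

/-!
# `Balaban1983to89.B6Repr2129Positivity` — T. Bałaban, *Propagators and renormalization transformations for lattice gauge
# theories. II*, Commun. Math. Phys. **96** (1984) 223–250 [Balaban1984PropagatorsII], Sect. C: the representation **(2.129)**
# p. 246 (and the Gaussian identity **(2.119)** p. 243) of `G = Δ_a⁻¹` FOR THE PRINTED OPERATORS `H_j` (2.130), `G̃_j` (2.131),
# `C^{(j)}_Λ`, `C̃^{(j)}_Λ`, with NO hypothesis beyond the printed lattice identities and the two printed positivity facts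

statement-level skeleton of published theorems with citation tags; proofs where landed; nothing here is a claim about the Yang–Mills mass gap

PDF held: `paper:balaban1984-cmp96-propagators-rt-ii` (journal page = PDF page + 222); pp. 239–246 read AS IMAGES on the ×2 renders
`run/shared/lean/pub/pub-balaban/b2b-balaban-ref1/pages/1984-cmp96-propagators-rt-II/` (2026-08-21).
CITATION HEADER (lean-in-tree rule).  WHAT IS REPRODUCED: lit-balaban SKELETON rows **B6.Eq2.129** and **B6.Eq2.119** (with
B6.Eq2.130/2.131).  The chain of this seat — `…B6GaussianIdentity2119` (gen 1), `…B6Repr2129` (gen 2), `…B6Eq2112Assembly` (gen 7: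
(2.95) ⇒ (2.112) ⇒ (2.119) ⇒ (2.129)), `…B6Eq2112Lebesgue` (gen 7: analytic hypotheses from four positivity constants) — proves
(2.129) over carriers in which EVERY derived operator (`R, P, R_j, P_j, G, C^{(j)}_Λ, H_j, G̃_j, Δ_j, C̃^{(j)}_Λ`), the two linear
changes of variables (2.96) / `dA = dB·dA↾{Q_jA = B}`, and four positivity constants are HYPOTHESES.  Here all of them are
DISCHARGED: the operators are the DEFINITIONS of `…B6SectCOperators` (notably `H_j := G_jQ_j*(Q_jG_jQ_j*)⁻¹` (2.130) and `G̃_j` =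
the printed (2.131)), their defining properties are the THEOREMS of `…B6SectCPositivity`, the changes of variables are
CONSTRUCTED here from (2.96) *"exactly one admissible ω′"* (`exists_e₁`) and from `Q_jH_j = I` (`exists_e₂`), the Lebesgue
measures are produced inside the proof, and the positivity constants follow (finite dimension) from the two printed facts
`…B6SectCOperators.TwoScaleData.Positive`: p. 226 *"the operator Δ_a is bounded from below by a positive constant"* and (2.11).
RESULT: `eq2129_of_pos` — (2.129) AS PRINTED for `D : TwoScaleData` under `D.IsLattice ∧ D.Positive` only; `eq2129_printed_of_pos`
(the same with (2.130)/(2.131) written out as `…B6SectA.hOp`/`tildeOp`); `eq2129_of_rightInverse` (for any right inverse `G` of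
`Δ_a`); `eq2119_of_pos` ((2.119) with its normalisation `Z″` for any Lebesgue measures `dB`, `dA↾{Q_jA = 0}`).  PHASE-2 seat p22
(gen 8); owner r03, referee ref-4.  IMPORTS, restating nothing: `…B6SectCPositivity` (same seat), `…B6Eq2112Lebesgue` (gen 7).

PRINT (p. 246, verbatim): *"We may calculate the integral in (2.119), and we get finally the desired identity ⟨J,GJ⟩ =
⟨J,∂H′_jC^{(j)}_ΛH′_j*∂*J⟩ + ⟨(J − ∂ΔH′_jC^{(j)}_ΛH′_j*∂*J), (G̃_j + H_jC̃^{(j)}_ΛH_j*)(J − ∂ΔH′_jC^{(j)}_ΛH′_j*∂*J)⟩. (2.129)  Let us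
recall that the operators H_j, G̃_j are given by the formulas H_j = G_jQ_j*(Q_jG_jQ_j*)⁻¹, (2.130) G̃_j = G_j − G_jQ_j*(Q_jG_jQ_j*)⁻¹
Q_jG_j, (2.131) where G_j was investigated in [4]."*

CONTENTS (theorems only; 0 defs; 0 sorry; standard axioms).  §1 the coercivity constants from `Positive` (`lap_coercive_NQ` (2.11),
`Dp_coercive` (2.110)).  §2 the two linear isomorphisms: `exists_axialPart` (the admissible `ω′` of (2.96) as a LINEAR function of
the block field), **`exists_e₁`** (every `A` is `A′ − ∂H′_jω` for exactly one gauge-fixed `A′` and one admissible `ω`: the change of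
variables (2.96)–(2.97)), **`exists_e₂`** (`{Q_jA axial} ≅ {axial B} × {Q_jA = 0}` via `A′ = A + H_jB`).  §3 **`eq2129_of_pos`**,
`eq2129_printed_of_pos`, `eq2129_of_rightInverse`, **`eq2119_of_pos`**.
HONEST SCOPE: finite-dimensional (Lebesgue) model of the printed finite-volume statement; hypotheses = `IsLattice` (rows B6.Eq2.19,
(2.96), (2.98), (2.101), (2.103)–(2.104)) + `Positive` (rows B6.Eq2.11, B6.Eq2.19/2.22); the UNIFORM constants (`δ₂`, `γ₀″`, decay)
of Prop. 2.5 are not touched; NOT summit progress.  Unit `lit-balaban-p22` (gen 8), HOME `run/shared/lean/pub/lit-balaban/`.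
-/

noncomputable section

open MeasureTheory
open scoped InnerProductSpace

namespace Literature.MathematicalPhysics.QuantumFieldTheory.Balaban1983to89.B6Repr2129Positivity

open B6CovarianceOperator B6SectCOperators B6SectCOperators.TwoScaleData B6SectCPositivity

variable {A B W T Bs V : Type*}
  [NormedAddCommGroup A] [InnerProductSpace ℝ A] [FiniteDimensional ℝ A]
  [NormedAddCommGroup B] [InnerProductSpace ℝ B] [FiniteDimensional ℝ B]
  [NormedAddCommGroup W] [InnerProductSpace ℝ W] [FiniteDimensional ℝ W]
  [NormedAddCommGroup T] [InnerProductSpace ℝ T] [FiniteDimensional ℝ T]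
  [NormedAddCommGroup Bs] [InnerProductSpace ℝ Bs] [FiniteDimensional ℝ Bs]
  [NormedAddCommGroup V] [InnerProductSpace ℝ V] [FiniteDimensional ℝ V]
  {D : TwoScaleData A B W T Bs V}

/-! ## §1  The coercivity constants, from the two positivity facts (finite dimension) -/

/-- (2.11) quantitatively: `‖Δλ‖² ≥ γ_Q‖λ‖²` on `N(Q′)` with `γ_Q > 0` (the hypothesis `hcoerQ` of `…B6Eq2112Lebesgue`).
[cite: Balaban1984PropagatorsII, (2.11) p.225] -/
theorem lap_coercive_NQ (hL : D.IsLattice) (hP : D.Positive) :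
    ∃ γ : ℝ, 0 < γ ∧ ∀ m : ↥D.NQ, γ * ‖(m : B)‖ ^ 2 ≤ ‖D.lap m‖ ^ 2 := by
  have hform : ∀ m : ↥D.NQ, ⟪m, compress D.NQ (LinearMap.adjoint D.lap ∘ₗ D.lap) m⟫_ℝ = ‖D.lap m‖ ^ 2 := by
    intro m
    rw [inner_compress, LinearMap.comp_apply, LinearMap.adjoint_inner_right, real_inner_self_eq_norm_sq]
  obtain ⟨γ, hγ, h⟩ := BalabanImbrieJaffe1984to88.BIJ85Eq461Proof.exists_coercive
    (compress D.NQ (LinearMap.adjoint D.lap ∘ₗ D.lap)) (fun m hm => by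
      rw [hform]
      have hne : D.lap (m : B) ≠ 0 := fun h0 => hm (hP.lapInj m h0)
      positivity)
  have _ := hL
  exact ⟨γ, hγ, fun m => by rw [← Submodule.coe_norm, ← hform]; exact h m⟩

/-- (2.110) quantitatively: `⟨ω,Δ′_jω⟩ ≥ γ_C‖ω‖²` on the admissible `ω` with `γ_C > 0` (the hypothesis `h2110`).
[cite: Balaban1984PropagatorsII, (2.110) p.242] -/
theorem Dp_coercive (hL : D.IsLattice) (hP : D.Positive) :
    ∃ γ : ℝ, 0 < γ ∧ ∀ ω : ↥D.S₁, γ * ‖(ω : W)‖ ^ 2 ≤ ⟪(ω : W), D.Dp ω⟫_ℝ := by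
  obtain ⟨γ, hγ, h⟩ := BalabanImbrieJaffe1984to88.BIJ85Eq461Proof.exists_coercive (compress D.S₁ D.Dp)
    (fun ω hω => by rw [inner_compress]; exact Dp_pos hL hP ω hω)
  exact ⟨γ, hγ, fun ω => by rw [← Submodule.coe_norm, ← inner_compress]; exact h ω⟩

/-! ## §2  The two linear changes of variables: (2.96) and `dA = dB·dA↾{Q_jA = B}` -/

/-- **(2.96) as a linear map**: the admissible `ω′` with `Q_jA + ∂₁ω′` axial depends linearly on the block field (uniqueness).
[cite: Balaban1984PropagatorsII, (2.96) p.240] -/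
theorem exists_axialPart (hL : D.IsLattice) :
    ∃ Ω : Bs →ₗ[ℝ] ↥D.S₁, ∀ (b : Bs) (ω : ↥D.S₁), b + D.d1 (ω : W) ∈ D.Ax ↔ ω = Ω b := by
  choose f hf using hL.axial
  have hmem : ∀ b, b + D.d1 (f b : W) ∈ D.Ax := fun b => (hf b).1
  have huniq : ∀ (b : Bs) (ω : ↥D.S₁), b + D.d1 (ω : W) ∈ D.Ax → ω = f b := fun b ω h => (hf b).2 ω h
  refine ⟨{ toFun := f, map_add' := fun b₁ b₂ => ?_, map_smul' := fun c b => ?_ }, fun b ω => ⟨huniq b ω, fun h => h ▸ hmem b⟩⟩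
  · symm
    refine huniq (b₁ + b₂) (f b₁ + f b₂) ?_
    have key : b₁ + b₂ + D.d1 ((f b₁ + f b₂ : ↥D.S₁) : W) = (b₁ + D.d1 (f b₁ : W)) + (b₂ + D.d1 (f b₂ : W)) := by
      rw [Submodule.coe_add, map_add]; abel
    rw [key]
    exact D.Ax.add_mem (hmem b₁) (hmem b₂)
  · symm
    refine huniq (c • b) (c • f b) ?_
    have key : c • b + D.d1 ((c • f b : ↥D.S₁) : W) = c • (b + D.d1 (f b : W)) := by
      rw [Submodule.coe_smul, map_smul, smul_add]
    rw [key]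
    exact D.Ax.smul_mem c (hmem b)

/-- **The change of variables (2.96)–(2.97)**: every configuration `A` is `A′ − ∂H′_jω` for exactly one gauge-fixed `A′` (`Q_jA′`
axial) and one admissible `ω` — a linear isomorphism `e₁ : {admissible ω} × {gauge-fixed A′} ≅ A`, the datum `e₁` of
`…B6Eq2112Assembly`; from (2.96), (2.103) `Q_j∂ = ∂₁Q′_j` and (2.101) `Q′_jH′_j = I`. [cite: Balaban1984PropagatorsII, (2.96)–(2.97) p.240] -/
theorem exists_e₁ (hL : D.IsLattice) :
    ∃ e₁ : (↥D.S₁ × ↥D.Sg) ≃L[ℝ] A, ∀ (ω : ↥D.S₁) (s : ↥D.Sg), e₁ (ω, s) = (s : A) - D.grad (D.hP (ω : W)) := by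
  obtain ⟨Ω, hΩ⟩ := exists_axialPart hL
  set F : (↥D.S₁ × ↥D.Sg) →ₗ[ℝ] A :=
    D.Sg.subtype ∘ₗ LinearMap.snd ℝ (↥D.S₁) (↥D.Sg) - D.grad ∘ₗ D.hP ∘ₗ D.S₁.subtype ∘ₗ LinearMap.fst ℝ (↥D.S₁) (↥D.Sg)
    with hF
  set Φ : A →ₗ[ℝ] A := LinearMap.id + D.grad ∘ₗ D.hP ∘ₗ D.S₁.subtype ∘ₗ Ω ∘ₗ D.Qv with hΦ
  have hΦv : ∀ v : A, Φ v = v + D.grad (D.hP (Ω (D.Qv v) : W)) := fun v => by simp [hΦ]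
  have hmem : ∀ v : A, Φ v ∈ D.Sg := by
    intro v
    rw [hΦv, Submodule.mem_comap, map_add, hL.Qv_grad, Qp_hP_apply hL]
    exact (hΩ _ _).mpr rfl
  set Gi : A →ₗ[ℝ] (↥D.S₁ × ↥D.Sg) := LinearMap.prod (Ω ∘ₗ D.Qv) (LinearMap.codRestrict D.Sg Φ hmem) with hGi
  have hFp : ∀ (ω : ↥D.S₁) (s : ↥D.Sg), F (ω, s) = (s : A) - D.grad (D.hP (ω : W)) := fun ω s => by simp [hF]
  have hGiv : ∀ v : A, Gi v = (Ω (D.Qv v), ⟨Φ v, hmem v⟩) := fun v => rfl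
  have h₁ : F ∘ₗ Gi = LinearMap.id := by
    refine LinearMap.ext fun v => ?_
    show F (Gi v) = v
    rw [hGiv, hFp]
    show Φ v - D.grad (D.hP (Ω (D.Qv v) : W)) = v
    rw [hΦv, add_sub_cancel_right]
  have h₂ : Gi ∘ₗ F = LinearMap.id := by
    refine LinearMap.ext fun p => ?_
    obtain ⟨ω, s⟩ := p
    have hω : Ω (D.Qv ((s : A) - D.grad (D.hP (ω : W)))) = ω := by
      symm
      refine (hΩ _ _).mp ?_
      rw [map_sub, hL.Qv_grad, Qp_hP_apply hL, sub_add_cancel]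
      exact s.2
    show Gi (F (ω, s)) = (ω, s)
    rw [hFp, hGiv]
    refine Prod.ext hω (Subtype.ext ?_)
    show Φ ((s : A) - D.grad (D.hP (ω : W))) = (s : A)
    rw [hΦv, hω, sub_add_cancel]
  refine ⟨(LinearEquiv.ofLinear F Gi h₁ h₂).toContinuousLinearEquiv, fun ω s => ?_⟩
  show F (ω, s) = _
  exact hFp ω s

/-- **`dA′ = dB·dA↾{Q_jA = B}`**: the gauge-fixed configurations are `A + H_jB` with `Q_jA = 0` and `B` axial, bijectively — the datum
`e₂` of `…B6Eq2112Assembly`, from `Q_jH_j = I` for the printed `H_j` (2.130). [cite: Balaban1984PropagatorsII, (2.112) p.243 + (2.130) p.246] -/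
theorem exists_e₂ (hL : D.IsLattice) (hP : D.Positive) :
    ∃ e₂ : (↥D.Ax × ↥D.NA) ≃L[ℝ] ↥D.Sg, ∀ (m : ↥D.Ax) (n : ↥D.NA), ((e₂ (m, n) : ↥D.Sg) : A) = (n : A) + D.Hj (m : Bs) := by
  have hmemF : ∀ p : ↥D.Ax × ↥D.NA, (D.NA.subtype ∘ₗ LinearMap.snd ℝ (↥D.Ax) (↥D.NA) +
      D.Hj ∘ₗ D.Ax.subtype ∘ₗ LinearMap.fst ℝ (↥D.Ax) (↥D.NA)) p ∈ D.Sg := by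
    rintro ⟨m, n⟩
    simp only [LinearMap.add_apply, LinearMap.coe_comp, Function.comp_apply, Submodule.coe_subtype, LinearMap.snd_apply,
      LinearMap.fst_apply, Submodule.mem_comap, map_add]
    rw [show D.Qv (n : A) = 0 from n.2, Qv_Hj hL hP, zero_add]
    exact m.2
  set F : (↥D.Ax × ↥D.NA) →ₗ[ℝ] ↥D.Sg := LinearMap.codRestrict D.Sg _ hmemF with hF
  have hmemB : ∀ s : ↥D.Sg, (D.Qv ∘ₗ D.Sg.subtype) s ∈ D.Ax := fun s => s.2
  have hmemN : ∀ s : ↥D.Sg, (D.Sg.subtype - D.Hj ∘ₗ D.Qv ∘ₗ D.Sg.subtype) s ∈ D.NA := by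
    intro s
    simp only [LinearMap.sub_apply, LinearMap.coe_comp, Function.comp_apply, Submodule.coe_subtype, LinearMap.mem_ker,
      map_sub]
    rw [Qv_Hj hL hP, sub_self]
  set Gi : ↥D.Sg →ₗ[ℝ] (↥D.Ax × ↥D.NA) :=
    LinearMap.prod (LinearMap.codRestrict D.Ax _ hmemB) (LinearMap.codRestrict D.NA _ hmemN) with hGi
  have h₁ : F ∘ₗ Gi = LinearMap.id := by
    refine LinearMap.ext fun s => Subtype.ext ?_
    simp [hF, hGi]
  have h₂ : Gi ∘ₗ F = LinearMap.id := by
    refine LinearMap.ext fun p => ?_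
    obtain ⟨m, n⟩ := p
    have hn : D.Qv (n : A) = 0 := n.2
    refine Prod.ext (Subtype.ext ?_) (Subtype.ext ?_)
    · simp [hF, hGi, hn, Qv_Hj hL hP]
    · simp [hF, hGi, hn, Qv_Hj hL hP]
  refine ⟨(LinearEquiv.ofLinear F Gi h₁ h₂).toContinuousLinearEquiv, fun m n => ?_⟩
  show ((F (m, n) : ↥D.Sg) : A) = _
  simp [hF]

/-! ## §3  (2.129) and (2.119) for the printed operators, from the two positivity facts -/

/-- **(2.129) p. 246 AS PRINTED, for the operators of `…B6SectCOperators`, under the printed lattice identities and the two printed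
positivity facts ONLY.**  *"⟨J,GJ⟩ = ⟨J,∂H′_jC^{(j)}_ΛH′_j*∂*J⟩ + ⟨(J − ∂ΔH′_jC^{(j)}_ΛH′_j*∂*J), (G̃_j + H_jC̃^{(j)}_ΛH_j*)(J −
∂ΔH′_jC^{(j)}_ΛH′_j*∂*J)⟩ (2.129)"* with `G = Δ_a⁻¹`, `H_j = G_jQ_j*(Q_jG_jQ_j*)⁻¹` (2.130), `G̃_j` the covariance (2.131), `C^{(j)}_Λ`,
`C̃^{(j)}_Λ` the covariances of `Δ′_j` / `Q″*aQ″ + Δ_j` — obtained from `…B6Eq2112Lebesgue.eq2129_lebesgue` by supplying every operator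
property from `…B6SectCPositivity`, the changes of variables `exists_e₁`/`exists_e₂`, Lebesgue measures, and the coercivity
constants of §1 / `deltaA_coercive` / `form2112_coercive`. [cite: Balaban1984PropagatorsII, (2.129)–(2.131) p.246] -/
theorem eq2129_of_pos (hL : D.IsLattice) (hP : D.Positive) (J : A) :
    ⟪J, D.G J⟫_ℝ = ⟪J, D.K1 J⟫_ℝ + ⟪J - D.K2 J, (D.Gt + D.Hj ∘ₗ D.Ct ∘ₗ LinearMap.adjoint D.Hj) (J - D.K2 J)⟫_ℝ := by
  borelize A
  borelize B
  borelize W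
  borelize Bs
  obtain ⟨e₁, he₁⟩ := exists_e₁ hL
  obtain ⟨e₂, he₂⟩ := exists_e₂ hL hP
  obtain ⟨γa, hγa, hΔa⟩ := deltaA_coercive hL hP
  obtain ⟨γQ, hγQ, hcoerQ⟩ := lap_coercive_NQ hL hP
  obtain ⟨γC, hγC, h2110⟩ := Dp_coercive hL hP
  obtain ⟨γ₂, hγ₂, hpos₂⟩ := form2112_coercive hL hP
  exact B6Eq2112Lebesgue.eq2129_lebesgue (Measure.addHaar : Measure A) (Measure.addHaar : Measure ↥D.Sg)
    (Measure.addHaar : Measure ↥D.Ax) (Measure.addHaar : Measure ↥D.NA) D.Qp D.S₁ (Measure.addHaar : Measure ↥D.S₁)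
    (Measure.addHaar : Measure ↥D.Nj) (Measure.addHaar : Measure ↥D.NQ)
    D.lap (lap_symm hL) (D.NQ.map D.lap) range_lap_NQ D.P P_apply (D.Nj.map D.lap) range_lap_Nj D.Rj D.Pj Rj_apply Pj_apply
    D.lapV D.curl D.grad D.dv (lapV_symm hL) (lapV_self hL) hL.grad_adj hL.dv_grad hL.curl_grad
    D.Qv D.Qpp (LinearMap.adjoint D.Q) D.a Qs_adj hL.a_symm D.G (deltaA_comp_G hL hP)
    D.hP (LinearMap.adjoint D.hP) (fun w b => (LinearMap.adjoint_inner_right _ _ _).symm) hL.Qp_hP D.d1 hL.Qv_grad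
    hL.Qpp_d1 hL.hP_orth D.C D.TC (C_symm hL hP) C_eq (C_sol hL hP)
    D.Sg.subtype e₁ he₁ D.Ax.subtype D.NA.subtype D.Hj (fun n => n.2) (Qv_Hj hL hP) e₂ he₂
    D.Gt D.Tt Gt_eq (Gt_sol hL hP) (Hj_crit hL hP) (LinearMap.adjoint D.Hj) Hjs_adj D.Δj h2118
    D.TB (LinearMap.adjoint D.Qpp) D.Ct Qpps_adj (Δj_symm hL) Ct_eq (Ct_sol hL hP)
    hγa hΔa hγQ hcoerQ hγC h2110 hγ₂ hpos₂ J

/-- **(2.129) with (2.130)/(2.131) written out** — `H_j = …B6SectA.hOp G_j Q_j* (Q_jG_jQ_j*)⁻¹` and `G̃_j = …B6SectA.tildeOp G_j Q_j Q_j*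
(Q_jG_jQ_j*)⁻¹ = G_j − G_jQ_j*(Q_jG_jQ_j*)⁻¹Q_jG_j` (*"Let us recall that the operators H_j, G̃_j are given by the formulas (2.130),
(2.131)"*). [cite: Balaban1984PropagatorsII, (2.129)–(2.131) p.246] -/
theorem eq2129_printed_of_pos (hL : D.IsLattice) (hP : D.Positive) (J : A) :
    ⟪J, D.G J⟫_ℝ = ⟪J, D.K1 J⟫_ℝ + ⟪J - D.K2 J,
      (B6SectA.tildeOp D.Gj D.Qv (LinearMap.adjoint D.Qv) D.Ej +
        B6SectA.hOp D.Gj (LinearMap.adjoint D.Qv) D.Ej ∘ₗ D.Ct ∘ₗ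
          LinearMap.adjoint (B6SectA.hOp D.Gj (LinearMap.adjoint D.Qv) D.Ej)) (J - D.K2 J)⟫_ℝ := by
  rw [← Gt_eq_tildeOp hL hP]
  exact eq2129_of_pos hL hP J

/-- (2.129) for ANY right inverse `G` of `Δ_a` (it is `Δ_a⁻¹`, `…B6SectCPositivity.eq_G_of_rightInverse`) — the form in which the
earlier files of this seat consume `G`. [cite: Balaban1984PropagatorsII, (2.22) p.226 + (2.129) p.246] -/
theorem eq2129_of_rightInverse (hL : D.IsLattice) (hP : D.Positive) (G : A →ₗ[ℝ] A) (hG : D.deltaA ∘ₗ G = LinearMap.id)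
    (J : A) :
    ⟪J, G J⟫_ℝ = ⟪J, D.K1 J⟫_ℝ + ⟪J - D.K2 J, (D.Gt + D.Hj ∘ₗ D.Ct ∘ₗ LinearMap.adjoint D.Hj) (J - D.K2 J)⟫_ℝ := by
  rw [eq_G_of_rightInverse hL hP G hG]
  exact eq2129_of_pos hL hP J

/-- **(2.119) p. 243 for the printed operators**, for any Lebesgue measures `dB` on the axial `B` (`νB`) and `dA↾{Q_jA = 0}` (`μN`),
with its normalisation `Z″` (a constant independent of `J`): *"e^{½⟨J,GJ⟩} = exp[½⟨J,∂H′_jC^{(j)}_ΛH′_j*∂*J⟩ + ½⟨J − ∂ΔH′_jC^{(j)}_Λ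
H′_j*∂*J, G̃_j(J − …)⟩] · Z″⁻¹∫dB Π_{y∈Λ′}δ_{Ax(y)}(B) exp[−½⟨Q″B,aQ″B⟩ − ½⟨B,Δ_jB⟩ + ⟨B, H_j*(J − ∂ΔH′_jC^{(j)}_ΛH′_j*∂*J)⟩] (2.119)"* —
`…B6Eq2112Assembly.eq2119_of_295` with every analytic and operator hypothesis supplied as in `eq2129_of_pos`.
[cite: Balaban1984PropagatorsII, (2.119) p.243] -/
theorem eq2119_of_pos [MeasurableSpace A] [BorelSpace A] [MeasurableSpace Bs] [BorelSpace Bs] (hL : D.IsLattice)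
    (hP : D.Positive) (νB : Measure ↥D.Ax) [νB.IsAddHaarMeasure] (μN : Measure ↥D.NA) [μN.IsAddHaarMeasure] :
    ∃ Zpp : ℝ, ∀ J : A,
      Real.exp ((1 / 2) * ⟪J, D.G J⟫_ℝ) =
        Real.exp ((1 / 2) * ⟪J, D.K1 J⟫_ℝ + (1 / 2) * ⟪J - D.K2 J, D.Gt (J - D.K2 J)⟫_ℝ) * Zpp *
          ∫ m, Real.exp (-(1 / 2) * ⟪D.Qpp (m : Bs), D.a (D.Qpp (m : Bs))⟫_ℝ - (1 / 2) * ⟪(m : Bs), D.Δj (m : Bs)⟫_ℝ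
            + ⟪(m : Bs), LinearMap.adjoint D.Hj (J - D.K2 J)⟫_ℝ) ∂νB := by
  borelize B
  borelize W
  obtain ⟨e₁, he₁⟩ := exists_e₁ hL
  obtain ⟨e₂, he₂⟩ := exists_e₂ hL hP
  obtain ⟨γa, hγa, hΔa⟩ := deltaA_coercive hL hP
  obtain ⟨γQ, hγQ, hcoerQ⟩ := lap_coercive_NQ hL hP
  obtain ⟨γC, hγC, h2110⟩ := Dp_coercive hL hP
  obtain ⟨γ₂, hγ₂, hpos₂⟩ := form2112_coercive hL hP
  set μA : Measure A := Measure.addHaar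
  set μS : Measure ↥D.Sg := Measure.addHaar
  set ν : Measure ↥D.S₁ := Measure.addHaar
  set μj : Measure ↥D.Nj := Measure.addHaar
  set μ' : Measure ↥D.NQ := Measure.addHaar
  obtain ⟨cX, hX⟩ := B6Eq2112Lebesgue.hX_lebesgue D.Qp D.hP hL.Qp_hP D.S₁ ν μj μ' D.lap (lap_symm hL) D.dv hγQ hcoerQ
  have hZI := B6Eq2112Lebesgue.Z_ne_zero_and_integrable μA D.lapV D.grad D.dv (D.NQ.map D.lap) D.P P_apply D.Qv D.Qpp
    (LinearMap.adjoint D.Q) D.a (lapV_symm hL) hL.grad_adj Qs_adj hL.a_symm D.G (deltaA_comp_G hL hP) hγa hΔa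
  refine ⟨?_, fun J => ?_⟩
  swap
  exact B6Eq2112Assembly.eq2119_of_295 μA ν μS νB μN μj μ' D.lap (lap_symm hL) D.NQ.subtype D.Nj.subtype
    (D.NQ.map D.lap) range_lap_NQ D.P P_apply (D.Nj.map D.lap) range_lap_Nj D.Rj D.Pj Rj_apply Pj_apply
    D.lapV D.curl D.grad D.dv (lapV_symm hL) (lapV_self hL) hL.grad_adj hL.dv_grad hL.curl_grad
    D.Qv D.Qpp (LinearMap.adjoint D.Q) D.a Qs_adj hL.a_symm D.G (deltaA_comp_G hL hP)
    D.hP (LinearMap.adjoint D.hP) (fun w b => (LinearMap.adjoint_inner_right _ _ _).symm) D.S₁.subtype D.Qp hL.Qp_hP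
    D.d1 hL.Qv_grad hL.Qpp_d1 hL.hP_orth (B6Eq2112Lebesgue.mem_comap_hP D.Qp D.hP hL.Qp_hP D.S₁) D.C D.TC (C_symm hL hP)
    C_eq (C_sol hL hP) (B6Eq2112Lebesgue.ZC_ne_zero D.S₁ ν D.Dp hγC h2110) cX hX
    (B6Eq2112Lebesgue.Zprime_ne_zero D.Qp D.S₁ μ' D.lap (lap_symm hL) hγQ hcoerQ)
    (B6Eq2112Lebesgue.ZprimeJ_ne_zero D.Qp D.S₁ μj D.lap (lap_symm hL) hγQ hcoerQ)
    D.Sg.subtype e₁ he₁ D.Ax.subtype D.NA.subtype D.Hj (fun n => n.2) (Qv_Hj hL hP) e₂ he₂ J (hZI.2 J)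
    (B6Eq2112Lebesgue.integrable_2112 μS D.Sg.subtype D.lapV D.grad D.dv D.Pj D.Qv D.Qpp D.a hγ₂ hpos₂ _) hZI.1
    D.Gt D.Tt Gt_eq (Gt_sol hL hP) (Hj_crit hL hP) (LinearMap.adjoint D.Hj) Hjs_adj D.Δj h2118

end Literature.MathematicalPhysics.QuantumFieldTheory.Balaban1983to89.B6Repr2129Positivity

end
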